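import Literature.AlgebraicGeometry.HodgeTheory.QuaternionicQuarticGenericModelHolds
import Summits.HodgeConjecture.HodgeConjecture.Theorems.Q8SymplecticPowersFamilyDeckOfGenericModel
import HarnessLib

/-!
# K1Q line `mechanism-v2`: the S6 deck-family ∃-package holds UNCONDITIONALLY (Kollár-free)

Route `HodgeConjecture/Q8SymplecticPowers`, crux K1Q `VeryGeneralQuaternionCommutatorsInHg` (stmt-HodgeConjecture-24190). Helper
(`--supports`; nothing here closes an item). The registered stub S6 `stub_familyDeckExistsQ` of skeleton v5 read
`Kollar2007_resolutionLiftsAutomorphisms → ∀ e even ≥ 4, <the Q8FamilyDeck ∃-package>` and was closed in that conditional form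
(`Q8SymplecticPowersStubFamilyDeckExistsQ.stub_familyDeckExistsQ`); the same ∃-package is the FAMILY HALF (the ∃-prefix
`W, 𝒳, π, τ, j, ι, …`) of the registered certificate stubs `stub_memberLocalCertificateQ4 ∕ stub_memberLocalCertificateQge6` of
the current skeleton v15. This file proves the package OUTRIGHT:

* `stub_familyDeckExistsQ_holds` — `∀ e even ≥ 4, <the Q8FamilyDeck ∃-package>`, no hypothesis: the generic smooth projective
  `Q₈`-model now exists unconditionally (`Q8Family.exists_genericModel_holds`, from the equivariant immersion of the generic étale
  chart into `ℙⁿ_K` with a linear `Q₈`-action, its reduced closure, and the tree's proved equivariant strong resolution in `ℙⁿ_K`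
  — Kollár 2007 Thm. 3.36 (1)(2)(4) ∕ §3.4.1 for ONE resolution, `Resolution.exists_equivariant_completion_resolution`), and
  `Q8SymplecticPowersFamilyDeckOfGenericModel.stub_familyDeckExistsQ_of_genericModel` turns it into the S6 consequent verbatim.

Honest scope: the deck FAMILY exists; the local certificates (LCERT₄ ∕ LCERT_{≥6}), S1, K1Q and HC are NOT proved here.
-/

set_option linter.dupNamespace false

open CategoryTheory AlgebraicGeometry

namespace Summit.HodgeConjecture.HodgeConjecture.Theorems.Q8SymplecticPowersFamilyDeckHolds

/-- **The S6 deck-family ∃-package, unconditionally**: for every even `e ≥ 4` there is a smooth projective family of surfaces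
over a non-empty smooth quasi-projective open of the parameter space carrying the deck pair `(τ, j)` (`τ⁴ = 1`, `j² = τ²`,
`τ j τ = j`) and a `(τ, j)`-equivariant open immersion of the explicit étale chart meeting every fibre (consequent of the registered
stub `stub_familyDeckExistsQ`, verbatim; proof = `stub_familyDeckExistsQ_of_genericModel` + `Q8Family.exists_genericModel_holds`).
[cite: Kollar2007, Thm. 3.36 (1)(2)(4) and §3.4.1 (p. 121)] [cite: EGAIV3, Thm. 8.10.5] -/
theorem stub_familyDeckExistsQ_holds :
    open Literature.AlgebraicGeometry.Motives Literature.AlgebraicGeometry.HodgeTheory Literature.AlgebraicGeometry.HodgeTheory.BettiUniverse Literature.AlgebraicGeometry.HodgeTheory.Q8Family Literature.AlgebraicGeometry.RelativeSpec Literature.AlgebraicGeometry.RelativeSpec.ActionOver Literature.Algebra.Lie Literature.Algebra.Lie.KatzRecognition CategoryTheory CategoryTheory.Limits MonoidalCategory CartesianMonoidalCategory AlgebraicGeometry in ∀ ⦃e : ℕ⦄, Even e → 4 ≤ e → ∃ (W : (Spec (.of (ParamRing e))).Opens) (𝒳 : SchemeOver ℂ) (π : 𝒳 ⟶ base W) (τ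 j : 𝒳 ⟶ 𝒳) (ι : (deckChart (fun i => (MvPolynomial.X i : ParamRing e)) ⊗ Over.mk W.ι).left ⟶ 𝒳.left), Nonempty (ComplexPoints (base W)) ∧ IsSmoothProjectiveFamily π 2 ∧ IsQuasiProjectiveOver 𝒳 ∧ IsQuasiProjectiveOver (base W) ∧ AlgebraicGeometry.SmoothOfRelativeDimension (Fintype.card (CIdx e)) (base W).hom ∧ (τ ≫ π = π ∧ j ≫ π = π ∧ τ ≫ τ ≫ τ ≫ τ = 𝟙 𝒳 ∧ j ≫ j = τ ≫ τ ∧ τ ≫ j ≫ τ = j) ∧ IsOpenImmersion ι ∧ ι ≫ π.left = (snd (deckChart (fun i => (MvPolynomial.X i : ParamRing e))) (Over.mk W.ι)).left ∧ ((Over.isoMk ((deckAction (fun i => (MvPolynomial.X i : ParamRing e))).aut (QuaternionGroup.a 1)) ((deckAction (fun i => (MvPolynomial.X i : ParamRing e))).aut_comp (QuaternionGroup.a 1))).hom ▷ Over.mk W.ι).left ≫ ι = ι ≫ τ.left ∧ ((Over.isoMk ((deckAction (fun i => (MvPolynomial.X i : ParamRing e))).aut (QuaternionGroup.xa 0)) ((deckAction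 (fun i => (MvPolynomial.X i : ParamRing e))).aut_comp (QuaternionGroup.xa 0))).hom ▷ Over.mk W.ι).left ≫ ι = ι ≫ j.left ∧ Function.Surjective (snd (deckChart (fun i => (MvPolynomial.X i : ParamRing e))) (Over.mk W.ι)).left :=
  Summit.HodgeConjecture.HodgeConjecture.Theorems.Q8SymplecticPowersFamilyDeckOfGenericModel.stub_familyDeckExistsQ_of_genericModel
    fun e he => Literature.AlgebraicGeometry.HodgeTheory.Q8Family.exists_genericModel_holds e he

end Summit.HodgeConjecture.HodgeConjecture.Theorems.Q8SymplecticPowersFamilyDeckHolds
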